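import Mathlib
import Summits.MatrixMultiplication.MatrixMultiplication.Theorems.LevelGradedCohnUmansLevelOneGL2DesignsCyclotomicLiftSRS

/-!
# Cyclotomic real lift — from the fixed-prime construction to the power bound `p^{3/2 − 1/d}`
(crux `LevelOneGL2Designs`, stmt-MatrixMultiplication-14080, wall stub `stub_tangencySets`;
wall-breaker axis k8/12 "parabola lifts over finite fields", generation 1)

Completes the two-kernel formalisation of Pohoata's cyclotomic real lift (files
`…RealLiftNoWrap`, `…CyclotomicLiftElements`, `…CyclotomicLiftSRS`) with the parameter choice
of arXiv:2607.20422, proof of Thm. 1.3: `M = ⌊(p/A)^{1/(2d)}⌋`, `A = 2 (24 d²)^d`.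

* `uniform_of_construction` : the analytic bookkeeping, stated for ANY fixed-prime construction
  with the flag count of `cyclotomicLift_srs` (reusable: it only sees the count
  `(2M+1)^d (2M²+1)^{d−1} ≤ |F| + 2 (2M²+1)^{d−1}` and the window `(24 d² M²)^d < p`);
* `cyclotomicLift_uniform` : `2d + 1` prime, `d ≥ 2`: `∃ c > 0, ∃ p₁, ∀ primes p ≥ p₁,
  (2d+1) ∣ p − 1 →` an SRS of `AG(2,p)` in the exact flag format of `stub_tangencySets` with
  `≥ c · p^{3/2 − 1/d}` flags;
* `stubFormat_exponent` : the stub's exact quantifier shape with `p^{3/2}` replaced by `p^{3/2 − 1/d}`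
  (cofinally many primes `≡ 1 (mod 2d+1)`, `Nat.exists_prime_gt_modEq_one`).

Relation to the rest of the tree (same day): Pohoata's Theorem 1.3 in its published form (both
classes `q ≡ ±1 (mod r)`, tangency-set format) is `Literature.Combinatorics.Extremal.
InducedMatchingsNearThreeHalves_holds` (`Literature/…/PointLineInducedMatchingsProofs.lean`, an
independent formalisation via the Galois-fixed half-norm), and the `∀ ε > 0` flag-format corollary
is `ParabolaLift.stubFormat_near_threeHalves` (`…TangencyNearThreeHalvesHolds.lean`); the present
chain is an alternative route (two conjugate degree-one reductions, `p² ∣ N_{ℚ(ζ)}(w)`) with the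
constants explicit at every fixed `d`.  None of this reaches `ε = 0`, the stub itself.

References: C. Pohoata, arXiv:2607.20422 (2026), Thm. 1.3, Prop. 5.1
[bib: Pohoata2026SharpExponentMinimalDistance].
-/

-- justification: the summit/problem path `MatrixMultiplication.MatrixMultiplication` is fixed by the
-- tree layout (D-0017), so the namespace necessarily repeats a component.
set_option linter.dupNamespace false
-- justification: `CyclotomicField` is a plain `def`; Mathlib itself elaborates its instances under
-- this option (see `Mathlib/NumberTheory/NumberField/Cyclotomic/Basic.lean`).
set_option backward.isDefEq.respectTransparency false

noncomputable section

open NumberField IsCyclotomicExtension Polynomial Finset Matrix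

namespace Summit.MatrixMultiplication.MatrixMultiplication.Theorems.LevelOneGL2Designs.CyclotomicLift

open RealLift ParabolaLift

variable (d : ℕ) [hr : Fact (Nat.Prime (d + d + 1))]

/-- A prime `p ≡ 1 (mod 2d+1)` has a primitive `(2d+1)`-st root of unity in `ZMod p`
(Cauchy's theorem in the cyclic group `(ZMod p)ˣ` of order `p - 1`). -/
theorem exists_isPrimitiveRoot {p : ℕ} [Fact p.Prime] (h : (d + d + 1) ∣ p - 1) :
    ∃ g : ZMod p, IsPrimitiveRoot g (d + d + 1) := by
  obtain ⟨u, hu⟩ := exists_prime_orderOf_dvd_card (G := (ZMod p)ˣ) (d + d + 1)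
    (by rwa [ZMod.card_units p])
  refine ⟨(u : ZMod p), ?_⟩
  have := IsPrimitiveRoot.orderOf (u : ZMod p)
  rwa [orderOf_units, hu] at this

/-- Elementary: `(2M)^{k+2} + 2 ≤ (2M+1)^{k+2}` for `M ≥ 1`. -/
theorem two_mul_pow_add_two_le (M k : ℕ) (hM : 1 ≤ M) :
    (2 * M) ^ (k + 2) + 2 ≤ (2 * M + 1) ^ (k + 2) := by
  have h1 : (2 * M) ^ (k + 1) ≤ (2 * M + 1) ^ (k + 1) :=
    Nat.pow_le_pow_left (by omega) _
  have h2 : 2 * M ≤ (2 * M) ^ (k + 1) := Nat.le_self_pow (by omega) _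
  calc (2 * M) ^ (k + 2) + 2 ≤ (2 * M) ^ (k + 2) + (2 * M) ^ (k + 1) := by omega
    _ = (2 * M) ^ (k + 1) * (2 * M + 1) := by ring
    _ ≤ (2 * M + 1) ^ (k + 1) * (2 * M + 1) := Nat.mul_le_mul_right _ h1
    _ = (2 * M + 1) ^ (k + 2) := by ring

/-- From the flag count of `cyclotomicLift_srs` to the clean lower bound `M^{3d-2} ≤ |F|`
(`d ≥ 2`, `M ≥ 1`). -/
theorem pow_le_card_of_count {d M F : ℕ} (hd : 2 ≤ d) (hM : 1 ≤ M)
    (h : (2 * M + 1) ^ d * (2 * M ^ 2 + 1) ^ (d - 1) ≤ F + 2 * (2 * M ^ 2 + 1) ^ (d - 1)) :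
    M ^ (3 * d - 2) ≤ F := by
  obtain ⟨k, rfl⟩ : ∃ k, d = k + 2 := ⟨d - 2, by omega⟩
  set Q := (2 * M ^ 2 + 1) ^ (k + 2 - 1) with hQ
  have h1 := two_mul_pow_add_two_le M k hM
  have h2 : ((2 * M) ^ (k + 2) + 2) * Q ≤ F + 2 * Q :=
    le_trans (Nat.mul_le_mul_right _ h1) h
  have h3 : (2 * M) ^ (k + 2) * Q ≤ F := by nlinarith
  have hQ' : (M ^ 2) ^ (k + 1) ≤ Q := by
    rw [hQ, show k + 2 - 1 = k + 1 by omega]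
    exact Nat.pow_le_pow_left (by nlinarith) _
  have h4 : M ^ (k + 2) ≤ (2 * M) ^ (k + 2) := Nat.pow_le_pow_left (by omega) _
  calc M ^ (3 * (k + 2) - 2) = M ^ (k + 2) * (M ^ 2) ^ (k + 1) := by
        rw [← pow_mul, ← pow_add]; congr 1; omega
    _ ≤ (2 * M) ^ (k + 2) * Q := Nat.mul_le_mul h4 hQ'
    _ ≤ F := h3

omit hr in
/-- **From a fixed-prime construction to a uniform power bound** (the analytic bookkeeping of
Pohoata 2026, proof of Thm. 1.3, isolated).  Suppose that for every prime `p` with property `P p`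
and every `M` with `(24 d² M²)^d < p` we are given a strong representative system of `AG(2,p)` with
the flag count of `cyclotomicLift_srs`.  Then (`d ≥ 2`) there are `c > 0` and `p₁` such that every
prime `p ≥ p₁` with `P p` carries one with `≥ c · p^{3/2 − 1/d}` flags: take
`M = ⌊(p/A)^{1/(2d)}⌋`, `A = 2 (24 d²)^d`. -/
theorem uniform_of_construction (hd : 2 ≤ d) (P : ℕ → Prop)
    (hcons : ∀ (p : ℕ) (_ : Fact p.Prime), P p → ∀ M : ℕ, (24 * d ^ 2 * M ^ 2) ^ d < p →
      ∃ F : Finset ((Fin 2 → ZMod p) × (Fin 2 → ZMod p)),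
        (2 * M + 1) ^ d * (2 * M ^ 2 + 1) ^ (d - 1) ≤ F.card + 2 * (2 * M ^ 2 + 1) ^ (d - 1) ∧
        ∀ f ∈ F, ∀ f' ∈ F, (dotProduct f.1 f'.2 = 1 ↔ f = f')) :
    ∃ c : ℝ, 0 < c ∧ ∃ p₁ : ℕ, ∀ (p : ℕ) (_ : Fact p.Prime), p₁ ≤ p → P p →
      ∃ S : Finset ((Fin 2 → ZMod p) × (Fin 2 → ZMod p)),
        c * (p : ℝ) ^ ((3 : ℝ) / 2 - 1 / d) ≤ S.card ∧
        ∀ f ∈ S, ∀ f' ∈ S, (dotProduct f.1 f'.2 = 1 ↔ f = f') := by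
  -- constants
  set A : ℝ := 2 * (24 * (d : ℝ) ^ 2) ^ d with hA
  have hd0 : (0 : ℝ) < d := by exact_mod_cast (show 0 < d by omega)
  have hA0 : 0 < A := by positivity
  set θ : ℝ := 1 / (2 * d) with hθ
  set e : ℝ := (3 : ℝ) / 2 - 1 / d with he
  have hθe : θ * ((3 * d - 2 : ℕ) : ℝ) = e := by
    rw [hθ, he, Nat.cast_sub (by omega)]
    push_cast
    field_simp
  set c : ℝ := 1 / (A ^ e * 2 ^ (3 * d - 2)) with hc
  have hc0 : 0 < c := by positivity
  refine ⟨c, hc0, ⌈A * (2 : ℝ) ^ (2 * d)⌉₊, fun p hp hp₁ hP => ?_⟩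
  have hp0 : (0 : ℝ) < p := by exact_mod_cast hp.out.pos
  -- the real parameter `y = (p/A)^{1/(2d)}` and `M = ⌊y⌋`
  set y : ℝ := ((p : ℝ) / A) ^ θ with hy
  have hy0 : 0 ≤ y := Real.rpow_nonneg (by positivity) _
  have hy_pow : y ^ (2 * d) = (p : ℝ) / A := by
    rw [hy, ← Real.rpow_natCast, ← Real.rpow_mul (by positivity), hθ]
    rw [show (1 : ℝ) / (2 * d) * ((2 * d : ℕ) : ℝ) = 1 by push_cast; field_simp]
    exact Real.rpow_one _
  have hy_pow' : y ^ (3 * d - 2) = (p : ℝ) ^ e / A ^ e := by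
    rw [hy, ← Real.rpow_natCast, ← Real.rpow_mul (by positivity), hθe,
      Real.div_rpow hp0.le hA0.le]
  -- `y ≥ 2` from `p ≥ p₁`
  have hy2 : 2 ≤ y := by
    have hpA : A * (2 : ℝ) ^ (2 * d) ≤ p := by
      have := Nat.le_ceil (A * (2 : ℝ) ^ (2 * d))
      exact this.trans (by exact_mod_cast hp₁)
    have h2d : (2 : ℝ) ^ (2 * d) ≤ y ^ (2 * d) := by
      rw [hy_pow, le_div_iff₀ hA0]; linarith
    by_contra hlt
    rw [not_le] at hlt
    have : y ^ (2 * d) < (2 : ℝ) ^ (2 * d) := pow_lt_pow_left₀ hlt hy0 (by omega)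
    linarith
  set M : ℕ := ⌊y⌋₊ with hM
  have hMle : (M : ℝ) ≤ y := Nat.floor_le hy0
  have hMgt : y < M + 1 := Nat.lt_floor_add_one y
  have hM1 : 1 ≤ M := by
    have : (0 : ℝ) < M := by linarith
    exact_mod_cast this
  have hMy : y / 2 ≤ M := by linarith
  -- the no-wrap hypothesis `(24 d² M²)^d < p`
  have hMp : (24 * d ^ 2 * M ^ 2) ^ d < p := by
    have h1 : ((24 * d ^ 2 * M ^ 2) ^ d : ℝ) ≤ p / 2 := by
      calc ((24 * d ^ 2 * M ^ 2) ^ d : ℝ) = (24 * (d : ℝ) ^ 2) ^ d * ((M : ℝ) ^ 2) ^ d := by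
            rw [← mul_pow]
        _ ≤ (24 * (d : ℝ) ^ 2) ^ d * (y ^ 2) ^ d := by
            gcongr
        _ = (24 * (d : ℝ) ^ 2) ^ d * (p / A) := by rw [← pow_mul, mul_comm 2 d, ← hy_pow]; ring_nf
        _ = p / 2 := by rw [hA]; field_simp
    have h2 : ((24 * d ^ 2 * M ^ 2) ^ d : ℝ) < p := by linarith
    exact_mod_cast h2
  -- the construction
  obtain ⟨F, hF, hprop⟩ := hcons p hp hP M hMp
  refine ⟨F, ?_, hprop⟩
  have hcount : M ^ (3 * d - 2) ≤ F.card := pow_le_card_of_count hd hM1 hF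
  have hcountR : (M : ℝ) ^ (3 * d - 2) ≤ F.card := by exact_mod_cast hcount
  calc c * (p : ℝ) ^ e = (y / 2) ^ (3 * d - 2) := by
        rw [div_pow, hy_pow', hc]
        field_simp
    _ ≤ (M : ℝ) ^ (3 * d - 2) := pow_le_pow_left₀ (by linarith) hMy _
    _ ≤ F.card := hcountR

/-- **Pohoata's theorem for `ℚ(ζ_{2d+1})⁺`, uniformly in the prime** (arXiv:2607.20422, Thm. 1.3 /
Prop. 5.1, the `q ≡ 1 (mod r)` half, in the format of `stub_tangencySets`).  Let `r = 2d + 1 ≥ 5`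
be prime.  There are `c > 0` and `p₁` such that for every prime `p ≥ p₁` with `p ≡ 1 (mod r)` the
affine plane over `ZMod p` carries a strong representative system with at least
`c · p^{3/2 − 1/d} = c · p^{3/2 − 2/(r−1)}` flags. -/
theorem cyclotomicLift_uniform (hd : 2 ≤ d) :
    ∃ c : ℝ, 0 < c ∧ ∃ p₁ : ℕ, ∀ (p : ℕ) (_ : Fact p.Prime), p₁ ≤ p → (d + d + 1) ∣ p - 1 →
      ∃ S : Finset ((Fin 2 → ZMod p) × (Fin 2 → ZMod p)),
        c * (p : ℝ) ^ ((3 : ℝ) / 2 - 1 / d) ≤ S.card ∧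
        ∀ f ∈ S, ∀ f' ∈ S, (dotProduct f.1 f'.2 = 1 ↔ f = f') := by
  refine uniform_of_construction d hd (fun p => (d + d + 1) ∣ p - 1) fun p hp hdvd M hM => ?_
  obtain ⟨g, hg⟩ := exists_isPrimitiveRoot d hdvd
  exact cyclotomicLift_srs d (by omega) g hg M hM

/-- **The stub's format at exponent `3/2 − 1/d`, unconditionally, for every `d ≥ 2` with `2d + 1`
prime** (cofinally many primes: Dirichlet for the progression `1 (mod 2d+1)` in its elementary
cyclotomic form `Nat.exists_prime_gt_modEq_one`). -/
theorem stubFormat_exponent (hd : 2 ≤ d) :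
    ∃ c : ℝ, 0 < c ∧ ∀ p₀ : ℕ, ∃ (p : ℕ) (_ : Fact p.Prime), p₀ ≤ p ∧
      ∃ S : Finset ((Fin 2 → ZMod p) × (Fin 2 → ZMod p)),
        c * (p : ℝ) ^ ((3 : ℝ) / 2 - 1 / d) ≤ S.card ∧
        ∀ f ∈ S, ∀ f' ∈ S, (dotProduct f.1 f'.2 = 1 ↔ f = f') := by
  obtain ⟨c, hc, p₁, h⟩ := cyclotomicLift_uniform d hd
  refine ⟨c, hc, fun p₀ => ?_⟩
  obtain ⟨p, hp, hlt, hmod⟩ := Nat.exists_prime_gt_modEq_one (max p₀ p₁) (k := d + d + 1) (by omega)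
  haveI : Fact p.Prime := ⟨hp⟩
  have hdvd : (d + d + 1) ∣ p - 1 := (Nat.modEq_iff_dvd' hp.one_lt.le).mp hmod.symm
  obtain ⟨S, hS, hprop⟩ := h p ⟨hp⟩ (le_of_lt (lt_of_le_of_lt (le_max_right _ _) hlt)) hdvd
  exact ⟨p, ⟨hp⟩, le_of_lt (lt_of_le_of_lt (le_max_left _ _) hlt), S, hS, hprop⟩

end Summit.MatrixMultiplication.MatrixMultiplication.Theorems.LevelOneGL2Designs.CyclotomicLift
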